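/-
Refuter work file (cdisprove-style) for the crux `KrwChromaticSteering.StandardFromStrong`
(stmt-PneNP-18539), route `route-PneNP-KrwChromaticSteering`.  Seat pnp-krw-ref-1, 2026-08-27.
Sorry-free.  Published with `ledger crux write stmt-PneNP-18539 Disproof.lean`.
-/
import Summits.PneNP.PneNP.Theses.KrwChromaticSteering
import Summits.PneNP.PneNP.Theorems.KrwChromaticSteeringCompositionIterationIterate
import Summits.PneNP.PneNP.Cruxes.StandardFromStrong.Lines.birth
import Literature.Computability.Complexity.KWDepthHardFunctions

/-!
# Disproof attempt on `StandardFromStrong` (C2) — findings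

**Verdict (2026-08-27): SURVIVES as typed — no kill.**  C2 says: for every non-constant `f` there is
ONE inner function `g₀` (intended: the `⋄`-hardest) such that every standard protocol for
`KW_{f ⋄ g₀}` converts, for EVERY inner `g`, into a protocol for the strong game `KW_f ⊛ KW_g` at
cost `O(log (m n))`; i.e. `max_g C(KW_f ⊛ KW_g) ≤ max_{g₀} C(KW_{f ⋄ g₀}) + O(log mn)`.
* C2 FOLLOWS from weak KRW (`standardFromStrong_of_weakKRW`, repeated below from the C1 work file: the weak-KRW
  `KW_f` protocol recomposed with the trivial `KW_g` protocol), and `C1 ∧ C2 ↔ WeakKRW`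
  (`weakKRW_iff_cruxes`); given C1, `C2 ↔ WeakKRW` (`standardFromStrong_iff_weakKRW`).  So an
  unconditional `¬ C2` refutes Meir's Conjecture 2; none is in print.  The literature's "first
  obstacle" (de Rezende–Meir–Nordström–Pitassi–Robere 2020, arXiv:2007.02740 pp. 5–6: a protocol for
  `KW_{f ⋄ g}` may answer in a row with `a_i = b_i`) concerns the SAME-`g` comparison
  `C(KW_f ⊛ KW_g)` vs `C(KW_{f ⋄ g})`, which is the stronger `StandardFromStrongSameG` below — it
  implies C2 (`standardFromStrong_of_sameG`) and is itself open (no counterexample known; all printed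
  composition savings — Sipser `⊕ ⋄ ⊕`, threshold examples, KRW95 §4 — are `O(1)` additive).
* §1 Neither hypothesis of C2 is load-bearing (`standardFromStrongNoHyps_iff`): constant `f` makes
  both games vacuous (`P' := P`), and at `n = 0` the protocol type is empty.  Information only.
* §2 The quantifier order IS load-bearing: the `∀ g₀` form is FALSE (`not_standardFromStrongForallG0`,
  unconditional, via `DepthHardFunctionsExist_holds`: `m = 1`, `f`, `g₀` dictators, `P = leaf`, `g`
  depth-hard).  The same witness kills the `∀ g₀` / `∀ g₁` forms of the line's two stubs
  (`not_rowCertification_forall_g0`, `not_entrySteering_forall_g1`), and both stubs as typed follow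
  from the crux (tree: `rowCertification_of_crux`, `entrySteering_of_crux`), hence from weak KRW —
  they are not refutable either short of `¬ weak KRW`.
* §3 Small cases (kit job `j281476`): at `(2,2)` `max_g C_strong(f, g) = max_g C_std(f ⋄ g)` for
  every non-constant `f` (gap `0`) and even same-`g`: `C(KW_f ⊛ KW_g) = C(KW_{f⋄g})` for all pairs;
  `(2,3)`, `(3,2)` strong-vs-standard and `(2,4)`, `(3,3)` standard tables in `TABLES.md` (evidence on
  the item).  Finite tables cannot refute the `∃ c` statement; they calibrate only.

## HANDOFF (next refuter seat)
Landed under `Theorems/StandardFromStrong/Negative/`: see item evidence notes (proposal ids).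
Do not look for a `¬ C2` family: it would be `¬ weak KRW`.  Informative next regimes: same-`g` gaps
`C(KW_f ⊛ KW_g) − C(KW_{f ⋄ g})` at `(3,3)` for the hardest `g` (job tables; the first size where a
positive gap could appear), and whether the `⋄`-maximiser `g₀` and the `⊛`-maximiser coincide.
-/

set_option linter.dupNamespace false
set_option autoImplicit false

namespace Summit.PneNP.PneNP.Cruxes.StandardFromStrong.Disproof

open Literature.Computability.Complexity
open Summit.PneNP.PneNP.Theorems.KrwCompositionIteration (exists_mul_succ_lt_two_pow)

universe u

/-! ## Shared with the C1 work file

The declarations of this section are VERBATIM copies of those in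
`Summits/PneNP/PneNP/Cruxes/StrongComposition/Disproof.lean` (C1 work file, same seat): crux work
files live in separate crux directories and are not importable from one another on the farm, so the
`WeakKRW` split and the trivial `KW_g` protocol are repeated here under this file's namespace. -/

section SharedWithC1File

/-- **Weak KRW conjecture, depth form** — verbatim the hypothesis of the route's assembly item
`CompositionIteration`: for every non-constant outer `f` SOME inner `g` makes the block composition
lose at most `O(log (m n))` below `D(f) + n`. [cite: Meir2023, Conjecture 2 (§1)] -/
def WeakKRW : Prop :=
  ∃ c : ℕ, ∀ m n : ℕ, 1 ≤ n → ∀ f : (Fin m → Bool) → Bool, (∃ a b, f a ≠ f b) →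
    ∃ g : (Fin n → Bool) → Bool, ∀ P : KWTree (Fin m × Fin n), P.Solves (blockComp f g) →
      ∃ Q : KWTree (Fin m), Q.Solves f ∧ Q.depth + n ≤ P.depth + c * (Nat.log 2 (m * n) + 1)

/-- The assembly item is literally `WeakKRW → (∃ L ∈ P, L ∉ NC¹)`. -/
theorem compositionIteration_iff :
    Summit.PneNP.PneNP.Theses.KrwChromaticSteering.CompositionIteration ↔
      (WeakKRW → ∃ L ∈ Literature.Computability.Complexity.Classes.P,
        L ∉ Literature.Computability.Complexity.NC1) :=
  Iff.rfl

/-- `WeakKRW → C1`: a strong protocol is in particular a standard one (`SolvesStrong.solves`), so the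
weak-KRW `g` works for the strong game with the same constant. -/
theorem strongComposition_of_weakKRW (h : WeakKRW) :
    Summit.PneNP.PneNP.Theses.KrwChromaticSteering.StrongComposition := by
  obtain ⟨c, h⟩ := h
  refine ⟨c, fun m n hn f hf => ?_⟩
  obtain ⟨g, hg⟩ := h m n hn f hf
  exact ⟨g, fun P hP => hg P hP.solves⟩

/-- `C1 ∧ C2 → WeakKRW` — the route's glue (`closes`), recorded here so that the split is an `iff`. -/
theorem weakKRW_of_cruxes
    (h1 : Summit.PneNP.PneNP.Theses.KrwChromaticSteering.StrongComposition)
    (h2 : Summit.PneNP.PneNP.Theses.KrwChromaticSteering.StandardFromStrong) : WeakKRW := by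
  obtain ⟨c₁, h1⟩ := h1
  obtain ⟨c₂, h2⟩ := h2
  refine ⟨c₁ + c₂, fun m n hn f hf => ?_⟩
  obtain ⟨g, hg⟩ := h1 m n hn f hf
  obtain ⟨g₀, hg₀⟩ := h2 m n hn f hf
  refine ⟨g₀, fun P hP => ?_⟩
  obtain ⟨P', hP', hd'⟩ := hg₀ g P hP
  obtain ⟨Q, hQ, hdQ⟩ := hg P' hP'
  refine ⟨Q, hQ, ?_⟩
  have hsplit : (c₁ + c₂) * (Nat.log 2 (m * n) + 1)
      = c₁ * (Nat.log 2 (m * n) + 1) + c₂ * (Nat.log 2 (m * n) + 1) := by ring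
  omega

/-! ### The "send your input" protocol for `KW_g` (depth `n + ⌊log₂ n⌋ + 1`) -/

section SendInput

variable {ι : Type u} [DecidableEq ι]

/-- The assignment `a` restricted to the listed coordinates (`false` elsewhere). -/
def restrictTo (l : List ι) (a : ι → Bool) : ι → Bool := fun j => if j ∈ l then a j else false

/-- Alice announces her bits at the listed coordinates, one round each, then the play continues in
`T w` where `w` records the announced bits. [folklore] -/
def aliceSend : List ι → ((ι → Bool) → KWTree ι) → KWTree ι
  | [], T => T fun _ => false
  | i :: l, T =>
      KWTree.alice (fun a => a i) (aliceSend l fun w => T (Function.update w i false))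
        (aliceSend l fun w => T (Function.update w i true))

omit [DecidableEq ι] in
private theorem update_restrictTo (l : List ι) (a : ι → Bool) (i : ι) [DecidableEq ι] :
    Function.update (restrictTo l a) i (a i) = restrictTo (i :: l) a := by
  funext j
  by_cases hj : j = i
  · subst hj; simp [restrictTo]
  · simp [restrictTo, hj]

/-- Run law of `aliceSend`. [folklore] -/
theorem run_aliceSend : ∀ (l : List ι) (T : (ι → Bool) → KWTree ι) (a b : ι → Bool),
    (aliceSend l T).run a b = (T (restrictTo l a)).run a b
  | [], T, a, b => by
    have : restrictTo ([] : List ι) a = fun _ => false := by funext j; simp [restrictTo]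
    simp [aliceSend, this]
  | i :: l, T, a, b => by
    simp only [aliceSend, KWTree.run_alice]
    cases hai : a i
    · simp only [Bool.false_eq_true, ↓reduceIte]
      rw [run_aliceSend l _ a b, ← update_restrictTo l a i, hai]
    · simp only [↓reduceIte]
      rw [run_aliceSend l _ a b, ← update_restrictTo l a i, hai]

/-- Depth law of `aliceSend`: `|l|` rounds plus the deepest continuation. [folklore] -/
theorem depth_aliceSend_le : ∀ (l : List ι) (T : (ι → Bool) → KWTree ι) (D : ℕ),
    (∀ w, (T w).depth ≤ D) → (aliceSend l T).depth ≤ l.length + D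
  | [], T, D, h => by simpa [aliceSend] using h _
  | i :: l, T, D, h => by
    have h0 := depth_aliceSend_le l (fun w => T (Function.update w i false)) D fun w => h _
    have h1 := depth_aliceSend_le l (fun w => T (Function.update w i true)) D fun w => h _
    simp only [aliceSend, KWTree.depth_alice, List.length_cons]
    omega

end SendInput

/-- The number of a coordinate where `u` and `v` differ (`0` if none). -/
noncomputable def firstDiff {n : ℕ} (u v : Fin n → Bool) : ℕ :=
  if h : ∃ i : Fin n, u i ≠ v i then ((Classical.choose h : Fin n) : ℕ) else 0

/-- `ℕ → Fin n` with junk value `⟨0, _⟩` out of range (needs `1 ≤ n`). -/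
def eltOf {n : ℕ} (hn : 1 ≤ n) (l : ℕ) : Fin n := if h : l < n then ⟨l, h⟩ else ⟨0, hn⟩

/-- Bob's stage once he knows Alice's input `u`: he names a differing coordinate in
`⌊log₂ n⌋ + 1` rounds. -/
noncomputable def bobStage {n : ℕ} (hn : 1 ≤ n) (u : Fin n → Bool) : KWTree (Fin n) :=
  KWTree.bobChoose (Nat.log 2 n + 1) (firstDiff u) fun l => KWTree.leaf (eltOf hn l)

/-- **The trivial `KW_g` protocol**: Alice sends her whole input (`n` rounds), Bob names a differing
coordinate (`⌊log₂ n⌋ + 1` rounds): every `g : {0,1}ⁿ → {0,1}` has `D(KW_g) ≤ n + ⌊log₂ n⌋ + 1`.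
[folklore; cite: KarchmerWigderson1990, §2 (trivial upper bound)] -/
theorem exists_solves_sendInput {n : ℕ} (hn : 1 ≤ n) (g : (Fin n → Bool) → Bool) :
    ∃ R : KWTree (Fin n), R.Solves g ∧ R.depth ≤ n + (Nat.log 2 n + 1) := by
  classical
  refine ⟨aliceSend (List.finRange n) (bobStage hn), ?_, ?_⟩
  · intro u v hu hv
    have hres : restrictTo (List.finRange n) u = u := by
      funext j; simp [restrictTo, List.mem_finRange]
    rw [run_aliceSend, hres]
    have hne : ∃ i : Fin n, u i ≠ v i := by
      by_contra hcon
      push Not at hcon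
      have huv : u = v := funext hcon
      rw [huv, hv] at hu
      exact Bool.false_ne_true hu
    have hfd : firstDiff u v = ((Classical.choose hne : Fin n) : ℕ) := by
      simp [firstDiff, dif_pos hne]
    have hlt : firstDiff u v < 2 ^ (Nat.log 2 n + 1) := by
      rw [hfd]
      exact lt_of_lt_of_le (Classical.choose hne).isLt (Nat.lt_pow_succ_log_self one_lt_two n).le
    simp only [bobStage]
    rw [KWTree.run_bobChoose _ _ _ u v hlt, KWTree.run_leaf, hfd]
    have helt : eltOf hn ((Classical.choose hne : Fin n) : ℕ) = Classical.choose hne := by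
      simp [eltOf]
    rw [helt]
    exact Classical.choose_spec hne
  · refine (depth_aliceSend_le _ _ (Nat.log 2 n + 1) fun w => ?_).trans ?_
    · exact KWTree.depth_bobChoose_le (Nat.log 2 n + 1) (firstDiff w)
        (fun l => KWTree.leaf (eltOf hn l)) 0 (fun j _ => by simp)
    · simp [List.length_finRange]

/-- A non-constant `f : {0,1}^m → {0,1}` forces `1 ≤ m`. -/
theorem one_le_of_nonconst {m : ℕ} {f : (Fin m → Bool) → Bool} (hf : ∃ a b, f a ≠ f b) : 1 ≤ m := by
  rcases Nat.eq_zero_or_pos m with rfl | hm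
  · obtain ⟨a, b, hab⟩ := hf
    exact absurd (congrArg f (Subsingleton.elim a b)) hab
  · exact hm

/-- `WeakKRW → C2` (with constant `c + 3`): turn the weak-KRW `KW_f` protocol `Q` (depth
`≤ D(P) + cL − n`) back into a STRONG protocol for `KW_f ⊛ KW_g`, for ANY `g`, by the obvious
protocol `compose g R Q` with `R` the trivial `KW_g` protocol (`n + ⌊log₂ n⌋ + 1` rounds):
depth `≤ D(P) + cL + ⌊log₂ n⌋ + 2 ≤ D(P) + (c + 3)·L`.  So C2, like C1, FOLLOWS from weak KRW. -/
theorem standardFromStrong_of_weakKRW (h : WeakKRW) :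
    Summit.PneNP.PneNP.Theses.KrwChromaticSteering.StandardFromStrong := by
  obtain ⟨c, h⟩ := h
  refine ⟨c + 3, fun m n hn f hf => ?_⟩
  obtain ⟨g₀, hg₀⟩ := h m n hn f hf
  refine ⟨g₀, fun g P hP => ?_⟩
  obtain ⟨Q, hQ, hQd⟩ := hg₀ P hP
  obtain ⟨R, hR, hRd⟩ := exists_solves_sendInput hn g
  refine ⟨KWTree.compose g R Q, KWTree.solvesStrong_compose hQ hR, ?_⟩
  rw [KWTree.depth_compose]
  have hm : 1 ≤ m := one_le_of_nonconst hf
  have hlog : Nat.log 2 n ≤ Nat.log 2 (m * n) :=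
    Nat.log_mono_right (Nat.le_mul_of_pos_left n hm)
  have hsplit : (c + 3) * (Nat.log 2 (m * n) + 1)
      = c * (Nat.log 2 (m * n) + 1) + 3 * (Nat.log 2 (m * n) + 1) := by ring
  omega

/-- **The exact split.**  The route's two cruxes are jointly EQUIVALENT to weak KRW (depth form):
neither can be refuted unconditionally without refuting Meir's Conjecture 2. -/
theorem weakKRW_iff_cruxes :
    WeakKRW ↔ (Summit.PneNP.PneNP.Theses.KrwChromaticSteering.StrongComposition ∧
      Summit.PneNP.PneNP.Theses.KrwChromaticSteering.StandardFromStrong) :=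
  ⟨fun h => ⟨strongComposition_of_weakKRW h, standardFromStrong_of_weakKRW h⟩,
    fun h => weakKRW_of_cruxes h.1 h.2⟩

/-- Over an empty coordinate type there is no protocol tree (every tree has a leaf). -/
theorem isEmpty_kwTree {ι : Type u} [h : IsEmpty ι] : IsEmpty (KWTree ι) :=
  ⟨fun P => by
    induction P with
    | leaf i => exact h.elim i
    | alice _ _ _ ih _ => exact ih
    | bob _ _ _ ih _ => exact ih⟩

end SharedWithC1File

/-! ## §0  Position of C2 relative to weak KRW -/

/-- Given C1, the crux C2 is EQUIVALENT to weak KRW (depth form). -/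
theorem standardFromStrong_iff_weakKRW
    (h1 : Summit.PneNP.PneNP.Theses.KrwChromaticSteering.StrongComposition) :
    Summit.PneNP.PneNP.Theses.KrwChromaticSteering.StandardFromStrong ↔ WeakKRW :=
  ⟨fun h2 => weakKRW_of_cruxes h1 h2, standardFromStrong_of_weakKRW⟩

/-! ## §1  The hypotheses `1 ≤ n` and non-constancy are NOT load-bearing -/

/-- C2 with BOTH hypotheses (`1 ≤ n`, `f` non-constant) dropped. -/
def StandardFromStrongNoHyps : Prop :=
  ∃ c : ℕ, ∀ m n : ℕ, ∀ f : (Fin m → Bool) → Bool,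
    ∃ g₀ : (Fin n → Bool) → Bool, ∀ g : (Fin n → Bool) → Bool,
      ∀ P : KWTree (Fin m × Fin n), P.Solves (blockComp f g₀) →
        ∃ P' : KWTree (Fin m × Fin n), P'.SolvesStrong f g ∧
          P'.depth ≤ P.depth + c * (Nat.log 2 (m * n) + 1)

/-- **Neither hypothesis of C2 carries weight**: for constant `f` every tree solves the (vacuous)
strong game, so `P' := P`; at `n = 0` there is no tree `P` at all.  (For the prover: ignore them.) -/
theorem standardFromStrongNoHyps_iff :
    StandardFromStrongNoHyps ↔ Summit.PneNP.PneNP.Theses.KrwChromaticSteering.StandardFromStrong := by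
  constructor
  · rintro ⟨c, h⟩
    exact ⟨c, fun m n _ f _ => h m n f⟩
  · rintro ⟨c, h⟩
    refine ⟨c, fun m n f => ?_⟩
    rcases Nat.eq_zero_or_pos n with rfl | hn
    · exact ⟨fun _ => true, fun g P => (isEmpty_kwTree.false P).elim⟩
    · by_cases hf : ∃ a b, f a ≠ f b
      · exact h m n hn f hf
      · push Not at hf
        refine ⟨fun _ => true, fun g P _ => ⟨P, ?_, Nat.le_add_right _ _⟩⟩
        intro X Y hX hY
        rw [blockComp_apply] at hX hY
        rw [hf _ (rowLabels g Y), hY] at hX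
        exact absurd hX (by simp)

/-! ## §2  The quantifier order `∃ g₀ ∀ g` is load-bearing -/

/-- STRENGTHENING (false): C2 for EVERY `g₀` (conversion from ANY standard composition game). -/
def StandardFromStrongForallG0 : Prop :=
  ∃ c : ℕ, ∀ m n : ℕ, 1 ≤ n → ∀ f : (Fin m → Bool) → Bool, (∃ a b, f a ≠ f b) →
    ∀ g₀ g : (Fin n → Bool) → Bool,
      ∀ P : KWTree (Fin m × Fin n), P.Solves (blockComp f g₀) →
        ∃ P' : KWTree (Fin m × Fin n), P'.SolvesStrong f g ∧
          P'.depth ≤ P.depth + c * (Nat.log 2 (m * n) + 1)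

/-- At `m = 1` with `f` the dictator, a strong protocol for `KW_f ⊛ KW_g` IS a `KW_g` protocol (same
depth): pull it back along `u ↦ (p ↦ u p.2)`. -/
theorem solves_of_solvesStrong_one {n : ℕ} {g : (Fin n → Bool) → Bool} {P' : KWTree (Fin 1 × Fin n)}
    (hP' : P'.SolvesStrong (fun a => a 0) g) :
    (P'.comap (fun u p => u p.2) (fun u p => u p.2) Prod.snd).Solves g := by
  intro u v hu hv
  rw [KWTree.run_comap]
  exact (hP' (fun p => u p.2) (fun p => v p.2)
    (by simp only [blockComp_apply, rowLabels_apply]; exact hu)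
    (by simp only [blockComp_apply, rowLabels_apply]; exact hv)).1

/-- **The `∀ g₀` form is FALSE** (unconditionally).  Witness: `m = 1`, `f a = a 0`, `g₀ u = u 0`,
`P = leaf (0, 0)` (depth `0`, solves `KW_{f ⋄ g₀}`: the entry `(0,0)` carries the value), and `g` a
depth-hard function from `DepthHardFunctionsExist_holds` (`D(KW_g) ≥ n − c₀ (⌊log₂ n⌋ + 1)`); a strong
protocol for `(f, g)` of depth `≤ c·(⌊log₂ n⌋ + 1)` would be a `KW_g` protocol of that depth
(`solves_of_solvesStrong_one`), impossible at `n = 2^t` with `(c + c₀)(t + 1) < 2^t`.  So the `g₀` of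
C2 must be chosen depth-hard: the `∃ g₀ ∀ g` order is load-bearing. -/
theorem not_standardFromStrongForallG0 : ¬ StandardFromStrongForallG0 := by
  rintro ⟨c, h⟩
  obtain ⟨c₀, hhard⟩ := DepthHardFunctionsExist_holds
  obtain ⟨t, ht⟩ := exists_mul_succ_lt_two_pow (c + c₀)
  have hn : 1 ≤ 2 ^ t := Nat.one_le_two_pow
  obtain ⟨g, hg⟩ := hhard (2 ^ t) hn
  let j0 : Fin (2 ^ t) := ⟨0, hn⟩
  obtain ⟨P', hP', hd⟩ := h 1 (2 ^ t) hn (fun a => a 0) ⟨fun _ => true, fun _ => false, by simp⟩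
    (fun u => u j0) g (KWTree.leaf ((0 : Fin 1), j0))
    (by
      intro X Y hX hY
      simp only [blockComp_apply, rowLabels_apply, row_apply] at hX hY
      simp [hX, hY])
  have h1 := hg _ (solves_of_solvesStrong_one hP')
  rw [KWTree.depth_comap, Nat.log_pow one_lt_two] at h1
  rw [KWTree.depth_leaf, one_mul, Nat.log_pow one_lt_two] at hd
  have hsplit : (c + c₀) * (t + 1) = c * (t + 1) + c₀ * (t + 1) := by ring
  omega

/-- STRENGTHENING (open, = dRMNPR20's "first obstacle" proper): the SAME-`g` conversion
`C(KW_f ⊛ KW_g) ≤ C(KW_{f ⋄ g}) + O(log (m n))` for every `g`. -/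
def StandardFromStrongSameG : Prop :=
  ∃ c : ℕ, ∀ m n : ℕ, 1 ≤ n → ∀ f : (Fin m → Bool) → Bool, (∃ a b, f a ≠ f b) →
    ∀ g : (Fin n → Bool) → Bool,
      ∀ P : KWTree (Fin m × Fin n), P.Solves (blockComp f g) →
        ∃ P' : KWTree (Fin m × Fin n), P'.SolvesStrong f g ∧
          P'.depth ≤ P.depth + c * (Nat.log 2 (m * n) + 1)

/-- Every composition game has SOME protocol (the obvious one from two trivial protocols). -/
theorem exists_solves_blockComp {m n : ℕ} (hm : 1 ≤ m) (hn : 1 ≤ n) (f : (Fin m → Bool) → Bool)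
    (g : (Fin n → Bool) → Bool) :
    ∃ d : ℕ, ∃ P : KWTree (Fin m × Fin n), P.Solves (blockComp f g) ∧ P.depth = d := by
  obtain ⟨Q, hQ, -⟩ := exists_solves_sendInput hm f
  obtain ⟨R, hR, -⟩ := exists_solves_sendInput hn g
  exact ⟨_, KWTree.compose g R Q, (KWTree.solvesStrong_compose hQ hR).solves, rfl⟩

/-- **Same-`g` ⇒ C2**: choose `g₀` maximising the standard complexity `C(KW_{f ⋄ g})` over the
(finite) set of inner functions; then `C(KW_f ⊛ KW_g) ≤ C(KW_{f⋄g}) + cL ≤ C(KW_{f⋄g₀}) + cL ≤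
D(P) + cL` for every `g` and every `P ⊨ KW_{f ⋄ g₀}`.  (So refuting C2 is at least as hard as
exhibiting a same-`g` saving `ω(log mn)`, for which no family is known.) -/
theorem standardFromStrong_of_sameG (h : StandardFromStrongSameG) :
    Summit.PneNP.PneNP.Theses.KrwChromaticSteering.StandardFromStrong := by
  classical
  obtain ⟨c, h⟩ := h
  refine ⟨c, fun m n hn f hf => ?_⟩
  have hm : 1 ≤ m := one_le_of_nonconst hf
  have hex : ∀ g : (Fin n → Bool) → Bool,
      ∃ d : ℕ, ∃ P : KWTree (Fin m × Fin n), P.Solves (blockComp f g) ∧ P.depth = d :=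
    fun g => exists_solves_blockComp hm hn f g
  obtain ⟨g₀, -, hmax⟩ := Finset.exists_max_image (Finset.univ : Finset ((Fin n → Bool) → Bool))
    (fun g => Nat.find (hex g)) Finset.univ_nonempty
  refine ⟨g₀, fun g P hP => ?_⟩
  obtain ⟨Pg, hPg, hPgd⟩ := Nat.find_spec (hex g)
  have h1 : Nat.find (hex g) ≤ Nat.find (hex g₀) := hmax g (Finset.mem_univ g)
  have h2 : Nat.find (hex g₀) ≤ P.depth := Nat.find_min' (hex g₀) ⟨P, hP, rfl⟩
  obtain ⟨P', hP', hd⟩ := h m n hn f hf g Pg hPg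
  exact ⟨P', hP', by omega⟩

/-! ### The line's stubs: implied by the crux; their `∀`-forms are false -/

open Summit.PneNP.PneNP.Cruxes.StandardFromStrong.Birth in
/-- At `m = 1`, `f` dictator: a row-certified tree IS a `KW_g` protocol (pull back along
`u ↦ (q ↦ u q.1.2)`, read the entry's column). -/
theorem solves_of_solvesRC_one {n : ℕ} {g : (Fin n → Bool) → Bool} {R : KWTree (RCIdx 1 n)}
    (hR : SolvesRC R (fun a => a 0) g) :
    (R.comap (fun u q => u q.1.2) (fun u q => u q.1.2) (fun q => q.1.2)).Solves g := by
  intro u v hu hv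
  rw [KWTree.run_comap]
  have key := (hR (fun p => u p.2) (fun p => v p.2)
    (by simp only [blockComp_apply, rowLabels_apply]; exact hu)
    (by simp only [blockComp_apply, rowLabels_apply]; exact hv)).1
  have hA : (pullback fun p : Fin 1 × Fin n => u p.2) = fun q : RCIdx 1 n => u q.1.2 := by
    funext q; simp [pullback]
  have hB : (pullback fun p : Fin 1 × Fin n => v p.2) = fun q : RCIdx 1 n => v q.1.2 := by
    funext q; simp [pullback]
  rw [hA, hB] at key
  exact key

open Summit.PneNP.PneNP.Cruxes.StandardFromStrong.Birth in
/-- **The `∀ g₀` form of `stub_rowCertification` is FALSE**: same witness as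
`not_standardFromStrongForallG0` (`m = 1`, dictators, leaf protocol, depth-hard `g`): at `m = 1` the
row-certified game `RC_{f,g}` is `KW_g`. The stub's `∃ g₀` must pick a `⋄`-hard `g₀`. -/
theorem not_rowCertification_forall_g0 :
    ¬ ∃ c : ℕ, ∀ m n : ℕ, 1 ≤ n → ∀ f : (Fin m → Bool) → Bool, (∃ a b, f a ≠ f b) →
      ∀ g₀ g : (Fin n → Bool) → Bool,
        ∀ P : KWTree (Fin m × Fin n), P.Solves (blockComp f g₀) →
          ∃ R : KWTree (RCIdx m n), SolvesRC R f g ∧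
            R.depth ≤ P.depth + c * (Nat.log 2 (m * n) + 1) := by
  rintro ⟨c, h⟩
  obtain ⟨c₀, hhard⟩ := DepthHardFunctionsExist_holds
  obtain ⟨t, ht⟩ := exists_mul_succ_lt_two_pow (c + c₀)
  have hn : 1 ≤ 2 ^ t := Nat.one_le_two_pow
  obtain ⟨g, hg⟩ := hhard (2 ^ t) hn
  let j0 : Fin (2 ^ t) := ⟨0, hn⟩
  obtain ⟨R, hR, hd⟩ := h 1 (2 ^ t) hn (fun a => a 0) ⟨fun _ => true, fun _ => false, by simp⟩
    (fun u => u j0) g (KWTree.leaf ((0 : Fin 1), j0))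
    (by
      intro X Y hX hY
      simp only [blockComp_apply, rowLabels_apply, row_apply] at hX hY
      simp [hX, hY])
  have h1 := hg _ (solves_of_solvesRC_one hR)
  rw [KWTree.depth_comap, Nat.log_pow one_lt_two] at h1
  rw [KWTree.depth_leaf, one_mul, Nat.log_pow one_lt_two] at hd
  have hsplit : (c + c₀) * (t + 1) = c * (t + 1) + c₀ * (t + 1) := by ring
  omega

open Summit.PneNP.PneNP.Cruxes.StandardFromStrong.Birth in
/-- **The `∀ g₁` form of `stub_entrySteering` is FALSE**: at `m = 1`, `g₁` dictator, the
row-certified game `RC_{f,g₁}` is solved by the depth-`0` leaf `((0,0),0)`, while for depth-hard `g`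
the strong game `KW_f ⊛ KW_g = KW_g` needs depth `≥ n − c₀(⌊log₂ n⌋ + 1)`. The stub's `∃ g₁` must
pick an `RC`-hard `g₁`. -/
theorem not_entrySteering_forall_g1 :
    ¬ ∃ c : ℕ, ∀ m n : ℕ, 1 ≤ n → ∀ f : (Fin m → Bool) → Bool, (∃ a b, f a ≠ f b) →
      ∀ g₁ g : (Fin n → Bool) → Bool,
        ∀ R : KWTree (RCIdx m n), SolvesRC R f g₁ →
          ∃ P' : KWTree (Fin m × Fin n), P'.SolvesStrong f g ∧
            P'.depth ≤ R.depth + c * (Nat.log 2 (m * n) + 1) := by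
  rintro ⟨c, h⟩
  obtain ⟨c₀, hhard⟩ := DepthHardFunctionsExist_holds
  obtain ⟨t, ht⟩ := exists_mul_succ_lt_two_pow (c + c₀)
  have hn : 1 ≤ 2 ^ t := Nat.one_le_two_pow
  obtain ⟨g, hg⟩ := hhard (2 ^ t) hn
  let j0 : Fin (2 ^ t) := ⟨0, hn⟩
  obtain ⟨P', hP', hd⟩ := h 1 (2 ^ t) hn (fun a => a 0) ⟨fun _ => true, fun _ => false, by simp⟩
    (fun u => u j0) g (KWTree.leaf ((((0 : Fin 1), j0)), (0 : Fin 1)))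
    (by
      intro X Y hX hY
      simp only [blockComp_apply, rowLabels_apply, row_apply] at hX hY
      simp [hX, hY])
  have h1 := hg _ (solves_of_solvesStrong_one hP')
  rw [KWTree.depth_comap, Nat.log_pow one_lt_two] at h1
  rw [KWTree.depth_leaf, one_mul, Nat.log_pow one_lt_two] at hd
  have hsplit : (c + c₀) * (t + 1) = c * (t + 1) + c₀ * (t + 1) := by ring
  omega

open Summit.PneNP.PneNP.Cruxes.StandardFromStrong.Birth in
/-- Both stubs of the line follow from weak KRW (via the crux and the tree's `…_of_crux` lemmas):
neither is refutable short of `¬ weak KRW`. -/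
theorem stubs_of_weakKRW (h : WeakKRW) :
    (∃ c : ℕ, ∀ m n : ℕ, 1 ≤ n → ∀ f : (Fin m → Bool) → Bool, (∃ a b, f a ≠ f b) →
      ∃ g₀ : (Fin n → Bool) → Bool, ∀ g : (Fin n → Bool) → Bool,
        ∀ P : KWTree (Fin m × Fin n), P.Solves (blockComp f g₀) →
          ∃ R : KWTree (RCIdx m n), SolvesRC R f g ∧
            R.depth ≤ P.depth + c * (Nat.log 2 (m * n) + 1)) ∧
    (∃ c : ℕ, ∀ m n : ℕ, 1 ≤ n → ∀ f : (Fin m → Bool) → Bool, (∃ a b, f a ≠ f b) →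
      ∃ g₁ : (Fin n → Bool) → Bool, ∀ g : (Fin n → Bool) → Bool,
        ∀ R : KWTree (RCIdx m n), SolvesRC R f g₁ →
          ∃ P' : KWTree (Fin m × Fin n), P'.SolvesStrong f g ∧
            P'.depth ≤ R.depth + c * (Nat.log 2 (m * n) + 1)) :=
  ⟨rowCertification_of_crux (standardFromStrong_of_weakKRW h),
    entrySteering_of_crux (standardFromStrong_of_weakKRW h)⟩

end Summit.PneNP.PneNP.Cruxes.StandardFromStrong.Disproof
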